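import Summits.CriticalPhenomena.CardyFormulaZ2.Theorems.StripClusterRates.Negative.KacFromAboveFalse

/-!
# Stub `band_nMul_rateTwo_limit_le_three_pi` (B4b) of line `two-cluster-rate-is-stationary-gap`
# (crux `CardyBoundaryCoulombGas.StripClusterRates`, stmt-CriticalPhenomena-13878)

**B4b · BAND LIMIT VS. KAC.** The band construction of the lead (three stacked bands of height
`h`, `h + 1`, `h` inside the strip of width `3h + 3`) gives `γ₂(3h+3) ≤ 3 γ₁(h)` for `h ≥ 1`
(hypothesis `hband`, supplied by the neighbouring stubs). Under the `γ₁`-half of the crux,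
`n · γ₁(n) → π/3`, every limit `L₂` of `n · γ₂(n)` therefore satisfies `L₂ ≤ 3π` — consistent with
the crux's claim `L₂ = 2π < 3π`.

Proof (pure real analysis): along the subsequence `n = 3h + 3`,
`(3h+3) · γ₂(3h+3) ≤ (3h+3) · 3 γ₁(h) = 9 · (h γ₁ h) + 9 · γ₁(h)`, and `h γ₁ h → π/3`,
`γ₁ h = (h γ₁ h)/h → 0`, so the right side tends to `3π`; conclude with `le_of_tendsto_of_tendsto`.
-/

noncomputable section

open MeasureTheory Filter Topology
open Literature.Probability.LatticeModels Literature.Probability.Percolation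

namespace Summit.CriticalPhenomena.CardyFormulaZ2.Cruxes.StripClusterRates.TwoClusterRateIsStationaryGap

/-- If `n · γ₁(n)` converges then `γ₁(n) → 0` (`γ₁ n = (n γ₁ n) / n` for `n ≥ 1`). [folklore] -/
theorem band_tendsto_zero_of_nMul_tendsto {γ₁ : ℕ → ℝ} {L : ℝ}
    (hγ₁ : Tendsto (fun n : ℕ ↦ (n : ℝ) * γ₁ n) atTop (𝓝 L)) : Tendsto γ₁ atTop (𝓝 0) := by
  refine (hγ₁.div_atTop tendsto_natCast_atTop_atTop).congr' ?_
  filter_upwards [eventually_ge_atTop 1] with n hn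
  have : (n : ℝ) ≠ 0 := by exact_mod_cast Nat.one_le_iff_ne_zero.mp hn
  field_simp

/-- **B4b — `band_nMul_rateTwo_limit_le_three_pi`.** If `γ₂(3h+3) ≤ 3 γ₁(h)` for all `h ≥ 1`
(the band construction) and `n · γ₁(n) → π/3` (the `γ₁`-half of the crux), then every limit `L₂`
of `n · γ₂(n)` satisfies `L₂ ≤ 3π`: along `n = 3h + 3`,
`(3h+3) γ₂(3h+3) ≤ 9 (h γ₁ h) + 9 γ₁ h → 9 · π/3 + 0 = 3π`. [folklore] -/
theorem band_nMul_rateTwo_limit_le_three_pi : ∀ γ₁ γ₂ : ℕ → ℝ, (∀ h : ℕ, 1 ≤ h → γ₂ (3 * h + 3) ≤ 3 * γ₁ h) → Tendsto (fun n : ℕ ↦ (n : ℝ) * γ₁ n) atTop (𝓝 (Real.pi / 3)) → ∀ L₂ : ℝ, Tendsto (fun n : ℕ ↦ (n : ℝ) * γ₂ n) atTop (𝓝 L₂) → L₂ ≤ 3 * Real.pi := by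
  intro γ₁ γ₂ hband hγ₁ L₂ hL
  -- the subsequence `n = 3h + 3`
  have hsub : Tendsto (fun h : ℕ ↦ 3 * h + 3) atTop atTop := by
    refine tendsto_atTop_mono (fun j ↦ ?_) tendsto_id
    simp only [id]; omega
  -- `γ₁ h → 0`
  have hγ₁0 : Tendsto γ₁ atTop (𝓝 0) := band_tendsto_zero_of_nMul_tendsto hγ₁
  -- the right side `(3h+3) · 3 γ₁ h = 9 (h γ₁ h) + 9 γ₁ h → 3π`
  have hR : Tendsto (fun h : ℕ ↦ ((3 * h + 3 : ℕ) : ℝ) * (3 * γ₁ h)) atTop (𝓝 (3 * Real.pi)) := by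
    have h2 : Tendsto (fun h : ℕ ↦ 9 * ((h : ℝ) * γ₁ h) + 9 * γ₁ h) atTop
        (𝓝 (9 * (Real.pi / 3) + 9 * 0)) :=
      (hγ₁.const_mul 9).add (hγ₁0.const_mul 9)
    have h3 : 9 * (Real.pi / 3) + 9 * (0 : ℝ) = 3 * Real.pi := by ring
    rw [h3] at h2
    refine h2.congr' (Eventually.of_forall fun h ↦ ?_)
    push_cast
    ring
  refine le_of_tendsto_of_tendsto (hL.comp hsub) hR ?_
  filter_upwards [eventually_ge_atTop 1] with h hh
  show ((3 * h + 3 : ℕ) : ℝ) * γ₂ (3 * h + 3) ≤ ((3 * h + 3 : ℕ) : ℝ) * (3 * γ₁ h)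
  exact mul_le_mul_of_nonneg_left (hband h hh) (by positivity)

end Summit.CriticalPhenomena.CardyFormulaZ2.Cruxes.StripClusterRates.TwoClusterRateIsStationaryGap

end
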